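import Mathlib
import Summits.Ventures.PercRepro2.Defs
import Summits.Ventures.PercRepro2.Harris
import Summits.Ventures.PercRepro2.Graph
import Summits.Ventures.PercRepro2.Induced
import Summits.Ventures.PercRepro2.WBern
import Summits.Ventures.PercRepro2.TypedBases
import Summits.Ventures.PercRepro2.CompHarris

/-!
# The typed-base coefficients of the principal two-vertex W-form are nonnegative
(blind cell PercRepro2, mine-1 g14; proofs/MINE1-WBERN.md §9; WBern.lean, TypedBases.lean, CompHarris.lean)

Three steps. (1) FIBRES: every pair of configurations with type vector `n` is `(copy1 n ω, copy2 n ω)`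
for `ω` its first component, and `ω ↦ (copy1 n ω, copy2 n ω)` is `2^k`-to-one onto the fibre (`k` = the
number of edges of type `0` or `2`), so `2^k · typedSum Φ n = Σ_ω Φ (copy1 n ω) (copy2 n ω)`
(`typedSum_eq_sum_copies`). (2) KERNEL: without avoided vertices the status pair kernel of `WBern.lean`
collapses to the term of the two statuses (`pairKernel_eq`), and for the test set `{x, y}` with the principal
up-sets `↑x`, `↑y` it is the product of the two side signs (`pairKernel_two` — the disjointness factor is
redundant: a vertex in both clusters has side sign `0`). (3) HARRIS: `CompHarris.expect_half_sideSign_mul_nonneg`.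
Hence `typedCoef_two_nonneg`: every typed-base coefficient of the two-vertex W-form `W_{xy} W_∅ − W_x W_y`
(no avoided vertex) is nonnegative — the principal case of `WBernRow` at `|F| = 2`, `T = ∅`, in the kernel.
(The up-set pairs other than `(↑x, ↑y)` and the avoided set are NOT covered: there the disjointness factor
is not redundant.)
-/

namespace Summit.Ventures.PercRepro2

open CompHarris

section Fibres

variable {E : Type*} [Fintype E] [DecidableEq E] {R : Type*} [CommRing R]

omit [Fintype E] [DecidableEq E] in
/-- Every pair with type vector `n` is the pair of copies read from its first component. -/
lemma eq_copies_of_typeVec {n : E → ℕ} {ω₁ ω₂ : Config E} (h : typeVec ω₁ ω₂ = n) :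
    ω₁ = copy1 n ω₁ ∧ ω₂ = copy2 n ω₁ := by
  constructor
  · funext e
    have he := congrFun h e
    unfold typeVec at he
    unfold copy1
    cases h1 : ω₁ e <;> cases h2 : ω₂ e <;> simp [h1, h2] at he <;> simp [← he]
  · funext e
    have he := congrFun h e
    unfold typeVec at he
    unfold copy2
    cases h1 : ω₁ e <;> cases h2 : ω₂ e <;> simp [h1, h2] at he <;> simp [← he]

omit [Fintype E] [DecidableEq E] in
/-- The copies of an admissible type vector have that type vector. -/
lemma typeVec_copies (n : E → ℕ) (hn : ∀ e, n e ≤ 2) (ω : Config E) :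
    typeVec (copy1 n ω) (copy2 n ω) = n := by
  funext e
  unfold typeVec copy1 copy2
  have := hn e
  interval_cases h : n e <;> simp
  cases ω e <;> simp

/-- The pair map `ω ↦ (copy1 n ω, copy2 n ω)`. -/
def copies (n : E → ℕ) (ω : Config E) : Config E × Config E := (copy1 n ω, copy2 n ω)

omit [Fintype E] [DecidableEq E] in
/-- Two configurations have the same copies iff they agree on the type-1 edges. -/
lemma copies_eq_iff (n : E → ℕ) (hn : ∀ e, n e ≤ 2) (ω ω' : Config E) :
    copies n ω = copies n ω' ↔ ∀ e, n e = 1 → ω e = ω' e := by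
  constructor
  · intro h e h1
    have := congrFun (congrArg Prod.fst h) e
    simp only [copies, copy1] at this
    have h2 : n e ≠ 2 := by omega
    have h0 : n e ≠ 0 := by omega
    simpa [h2, h0] using this
  · intro h
    unfold copies copy1 copy2
    refine Prod.ext ?_ ?_ <;> funext e <;> by_cases h2 : n e = 2 <;> by_cases h0 : n e = 0 <;> simp [h2, h0]
    · by_cases h1 : n e = 1
      · exact h e h1
      · exfalso; have := hn e; omega
    · by_cases h1 : n e = 1
      · rw [h e h1]
      · exfalso; have := hn e; omega

/-- The type-1 edges of `n`. -/
def ones (n : E → ℕ) : Finset E := Finset.univ.filter (fun e => n e = 1)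

/-- The configurations agreeing with `σ` on the type-1 edges are in bijection with the configurations of
the other edges. -/
def agreeEquiv (n : E → ℕ) (σ : Config E) :
    {ω : Config E // ∀ e, n e = 1 → ω e = σ e} ≃ ({e : E // n e ≠ 1} → Bool) where
  toFun ω := fun e => ω.1 e.1
  invFun f := ⟨fun e => if h : n e = 1 then σ e else f ⟨e, h⟩, fun e h1 => by simp [h1]⟩
  left_inv := by
    intro ω
    apply Subtype.ext
    funext e
    by_cases h1 : n e = 1
    · simp [h1, ω.2 e h1]
    · simp [h1]
  right_inv := by
    intro f
    funext e
    simp [e.2]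

/-- The number of configurations agreeing with `σ` on the type-1 edges is `2^(number of other edges)`. -/
lemma card_agree (n : E → ℕ) (σ : Config E) :
    (Finset.univ.filter (fun ω : Config E => ∀ e, n e = 1 → ω e = σ e)).card =
      2 ^ (Finset.univ.filter (fun e => n e ≠ 1)).card := by
  classical
  rw [← Fintype.card_subtype, Fintype.card_congr (agreeEquiv n σ), Fintype.card_fun, Fintype.card_bool,
    Fintype.card_subtype]

/-- **The typed sum in the complementary model**: `2^k · typedSum Φ n = Σ_ω Φ (copy1 n ω) (copy2 n ω)`,
`k` = the number of edges of type `0` or `2`. -/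
theorem typedSum_eq_sum_copies (Φ : Config E → Config E → R) (n : E → ℕ) (hn : ∀ e, n e ≤ 2) :
    (2 : R) ^ (Finset.univ.filter (fun e => n e ≠ 1)).card * typedSum Φ n =
      ∑ ω : Config E, Φ (copy1 n ω) (copy2 n ω) := by
  classical
  have himg : (Finset.univ : Finset (Config E)).image (copies n) =
      (Finset.univ : Finset (Config E × Config E)).filter (fun x => typeVec x.1 x.2 = n) := by
    ext y
    simp only [Finset.mem_image, Finset.mem_univ, true_and, Finset.mem_filter]
    constructor
    · rintro ⟨ω, rfl⟩
      exact typeVec_copies n hn ω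
    · intro hy
      refine ⟨y.1, ?_⟩
      obtain ⟨h1, h2⟩ := eq_copies_of_typeVec hy
      unfold copies
      exact Prod.ext h1.symm h2.symm
  set Φ' : Config E × Config E → R := fun y => Φ y.1 y.2 with hΦ'
  have hsum : ∑ ω : Config E, Φ (copy1 n ω) (copy2 n ω) = ∑ ω : Config E, Φ' (copies n ω) := rfl
  have hcomp := Finset.sum_comp (s := (Finset.univ : Finset (Config E))) Φ' (copies n)
  rw [hsum, hcomp, himg]
  unfold typedSum
  rw [Finset.mul_sum]
  refine Finset.sum_congr rfl fun y hy => ?_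
  have hy' : typeVec y.1 y.2 = n := (Finset.mem_filter.mp hy).2
  have hcard : (Finset.univ.filter (fun ω : Config E => copies n ω = y)).card =
      2 ^ (Finset.univ.filter (fun e => n e ≠ 1)).card := by
    have hyc : y = copies n y.1 := by
      obtain ⟨h1, h2⟩ := eq_copies_of_typeVec hy'
      exact Prod.ext h1 h2
    have hset : (Finset.univ.filter (fun ω : Config E => copies n ω = y)) =
        Finset.univ.filter (fun ω : Config E => ∀ e, n e = 1 → ω e = y.1 e) := by
      ext ω
      simp only [Finset.mem_filter, Finset.mem_univ, true_and]
      conv_lhs => rw [hyc]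
      rw [copies_eq_iff n hn]
    rw [hset, card_agree]
  rw [hcard, nsmul_eq_mul]
  push_cast
  simp only [hΦ']


end Fibres

section Kernel

open scoped Classical

variable {V : Type*} {E : Type*} [Fintype E] [DecidableEq E] [Fintype V] [DecidableEq V]
  {R : Type*} [CommRing R]

variable (ends : E → Sym2 V) (s : V)

/-- the status of a configuration as a finset -/
noncomputable def st (F : Finset V) (ω : Config E) : Finset V := F.filter (fun v => Conn ends ω s v)

omit [DecidableEq E] in
/-- With `T = ∅`, the status event `statusEvent ∅ F S` is the fibre `{ω | st F ω = S}` of the status map. -/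
lemma mem_statusEvent_iff (F S : Finset V) (ω : Config E) :
    ω ∈ statusEvent ends s ∅ F S ↔ S = st ends s F ω := by
  unfold statusEvent st
  by_cases hS : S ⊆ F
  · rw [if_pos hS]
    simp only [Set.mem_inter_iff, connAll, avoidAll, Set.mem_setOf_eq, Finset.empty_union, Finset.mem_sdiff]
    constructor
    · rintro ⟨hc, hn⟩
      ext v
      simp only [Finset.mem_filter]
      constructor
      · intro hv; exact ⟨hS hv, hc v hv⟩
      · rintro ⟨hvF, hvc⟩
        by_contra hvS
        exact hn v ⟨hvF, hvS⟩ hvc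
    · intro h
      subst h
      refine ⟨fun a ha => (Finset.mem_filter.mp ha).2, fun v hv hc => ?_⟩
      exact hv.2 (Finset.mem_filter.mpr ⟨hv.1, hc⟩)
  · rw [if_neg hS]
    simp only [Set.mem_empty_iff_false, false_iff]
    intro h
    exact hS (h ▸ Finset.filter_subset _ _)

omit [DecidableEq E] in
/-- The pair kernel without avoided vertices collapses to the term of the two statuses. -/
lemma pairKernel_eq (F : Finset V) (g h : Finset V → R) (ω₁ ω₂ : Config E) :
    pairKernel ends s ∅ F g h ω₁ ω₂ =
      (if Disjoint (st ends s F ω₁) (st ends s F ω₂) then (1 : R) else 0) *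
        ((g (st ends s F ω₁) - g (st ends s F ω₂)) * (h (st ends s F ω₁) - h (st ends s F ω₂))) := by
  unfold pairKernel
  rw [Finset.sum_eq_single (st ends s F ω₁)]
  · rw [Finset.sum_eq_single (st ends s F ω₂)]
    · have h1 : ω₁ ∈ statusEvent ends s ∅ F (st ends s F ω₁) := (mem_statusEvent_iff ends s F _ ω₁).mpr rfl
      have h2 : ω₂ ∈ statusEvent ends s ∅ F (st ends s F ω₂) := (mem_statusEvent_iff ends s F _ ω₂).mpr rfl
      simp [Set.indicator_of_mem h1, Set.indicator_of_mem h2]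
    · intro S' _ hS'
      have : ω₂ ∉ statusEvent ends s ∅ F S' := fun h => hS' ((mem_statusEvent_iff ends s F S' ω₂).mp h)
      simp [Set.indicator_of_notMem this]
    · intro h; exact absurd (Finset.mem_univ _) h
  · intro S _ hS
    have : ω₁ ∉ statusEvent ends s ∅ F S := fun h => hS ((mem_statusEvent_iff ends s F S ω₁).mp h)
    simp [Set.indicator_of_notMem this]
  · intro h; exact absurd (Finset.mem_univ _) h

omit [DecidableEq E] [Fintype V] in
/-- the side sign of `x` for a pair of configurations -/
noncomputable def sig (x : V) (ω₁ ω₂ : Config E) : R :=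
  (if x ∈ cluster ends ω₁ s then 1 else 0) - (if x ∈ cluster ends ω₂ s then 1 else 0)

omit [DecidableEq E] in
/-- Membership in the status: `v ∈ st F ω` iff `v ∈ F` and `v` lies in the open cluster of the root. -/
lemma mem_st_iff (F : Finset V) (ω : Config E) (v : V) :
    v ∈ st ends s F ω ↔ v ∈ F ∧ v ∈ cluster ends ω s := by
  unfold st; simp only [Finset.mem_filter]; rfl

omit [DecidableEq E] in
/-- For the test set `{x, y}` and the principal up-sets, the pair kernel is the product of the side signs. -/
theorem pairKernel_two (x y : V) (ω₁ ω₂ : Config E) :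
    pairKernel ends s ∅ {x, y} (fun S => if x ∈ S then (1 : R) else 0) (fun S => if y ∈ S then (1 : R) else 0) ω₁ ω₂ =
      sig ends s x ω₁ ω₂ * sig ends s y ω₁ ω₂ := by
  rw [pairKernel_eq]
  have hx1 : x ∈ st ends s {x, y} ω₁ ↔ x ∈ cluster ends ω₁ s := by rw [mem_st_iff]; simp
  have hx2 : x ∈ st ends s {x, y} ω₂ ↔ x ∈ cluster ends ω₂ s := by rw [mem_st_iff]; simp
  have hy1 : y ∈ st ends s {x, y} ω₁ ↔ y ∈ cluster ends ω₁ s := by rw [mem_st_iff]; simp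
  have hy2 : y ∈ st ends s {x, y} ω₂ ↔ y ∈ cluster ends ω₂ s := by rw [mem_st_iff]; simp
  unfold sig
  by_cases hD : Disjoint (st ends s {x, y} ω₁) (st ends s {x, y} ω₂)
  · rw [if_pos hD, one_mul]
    simp only [hx1, hx2, hy1, hy2]
  · rw [if_neg hD, zero_mul]
    -- some vertex of {x, y} lies in both statuses, so its factor vanishes
    rw [Finset.not_disjoint_iff] at hD
    obtain ⟨v, hv1, hv2⟩ := hD
    have hvF : v ∈ ({x, y} : Finset V) := (mem_st_iff ends s _ ω₁ v).mp hv1 |>.1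
    simp only [Finset.mem_insert, Finset.mem_singleton] at hvF
    rcases hvF with rfl | rfl
    · have a1 := hx1.mp hv1; have a2 := hx2.mp hv2
      simp [a1, a2]
    · have b1 := hy1.mp hv1; have b2 := hy2.mp hv2
      simp [b1, b2]


end Kernel

section Main

open scoped Classical

variable {V : Type*} {E : Type*} [Fintype E] [DecidableEq E] [Fintype V] [DecidableEq V]
  {R : Type*} [Field R] [LinearOrder R] [IsStrictOrderedRing R]

variable (ends : E → Sym2 V) (s : V)

omit [Fintype V] [DecidableEq V] in
/-- The uniform expectation is `2^{-|E|}` times the plain sum. -/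
lemma sum_eq_pow_mul_expect_half (f : Config E → R) :
    ∑ ω : Config E, f ω = (2 : R) ^ (Fintype.card E) * expect (half : E → R) f := by
  unfold expect
  rw [Finset.mul_sum]
  refine Finset.sum_congr rfl fun ω _ => ?_
  have hw : weight (half : E → R) ω = (1 / 2 : R) ^ (Fintype.card E) := by
    unfold weight
    rw [← Finset.card_univ, ← Finset.prod_const]
    refine Finset.prod_congr rfl fun e _ => ?_
    unfold half edgeFactor
    cases ω e <;> norm_num
  rw [hw, ← mul_assoc, ← mul_pow]
  norm_num

omit [Fintype E] [DecidableEq E] [Fintype V] [DecidableEq V] [LinearOrder R] [IsStrictOrderedRing R] in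
/-- `sig` on the copies is the side sign. -/
lemma sig_copies (x : V) (n : E → ℕ) (ω : Config E) :
    sig ends s x (copy1 n ω) (copy2 n ω) = (sideSign ends s x n ω : R) := rfl

omit [Fintype E] [DecidableEq E] [Fintype V] [DecidableEq V] in
/-- Type vectors never exceed `2`. -/
lemma typeVec_le_two (ω₁ ω₂ : Config E) (e : E) : typeVec ω₁ ω₂ e ≤ 2 := by
  unfold typeVec
  cases ω₁ e <;> cases ω₂ e <;> simp

/-- **The typed-base coefficients of the principal two-vertex W-form are nonnegative** (given Harris for the
side signs, `hH`). -/
theorem typedCoef_two_nonneg (x y : V) (n : E → ℕ) :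
    0 ≤ typedCoef ends s ∅ {x, y}
      (fun S => if x ∈ S then (1 : R) else 0) (fun S => if y ∈ S then (1 : R) else 0) n := by
  have hH : 0 ≤ expect (half : E → R) (sideSign ends s x n * sideSign ends s y n) :=
    expect_half_sideSign_mul_nonneg ends s x y n
  rw [← typedSum_pairKernel]
  by_cases hn : ∀ e, n e ≤ 2
  · have key := typedSum_eq_sum_copies (pairKernel ends s ∅ {x, y}
      (fun S => if x ∈ S then (1 : R) else 0) (fun S => if y ∈ S then (1 : R) else 0)) n hn
    have hsum2 : ∑ ω : Config E, pairKernel ends s ∅ {x, y}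
        (fun S => if x ∈ S then (1 : R) else 0) (fun S => if y ∈ S then (1 : R) else 0)
        (copy1 n ω) (copy2 n ω) =
        ∑ ω : Config E, sideSign ends s x n ω * sideSign ends s y n ω := by
      refine Finset.sum_congr rfl fun ω _ => ?_
      rw [pairKernel_two, sig_copies, sig_copies]
    rw [hsum2, sum_eq_pow_mul_expect_half] at key
    have hpos : (0 : R) < (2 : R) ^ (Finset.univ.filter (fun e => n e ≠ 1)).card := by positivity
    have hH' : (0 : R) ≤ expect (half : E → R)
        (fun ω => sideSign ends s x n ω * sideSign ends s y n ω) := hH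
    have h2 : (0 : R) ≤ (2 : R) ^ (Fintype.card E) * expect (half : E → R)
        (fun ω => sideSign ends s x n ω * sideSign ends s y n ω) :=
      mul_nonneg (pow_nonneg (by norm_num) _) hH'
    rw [← key] at h2
    exact (mul_nonneg_iff_of_pos_left hpos).mp h2
  · rw [not_forall] at hn
    obtain ⟨e, he⟩ := hn
    rw [not_le] at he
    have hempty : (Finset.univ : Finset (Config E × Config E)).filter
        (fun x => typeVec x.1 x.2 = n) = ∅ := by
      ext p
      simp only [Finset.mem_filter, Finset.mem_univ, true_and, Finset.notMem_empty, iff_false]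
      intro h
      have := typeVec_le_two p.1 p.2 e
      rw [h] at this
      omega
    unfold typedSum
    rw [hempty, Finset.sum_empty]


end Main

end Summit.Ventures.PercRepro2
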